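import Summits.AtomisticToContinuum.Crystallization.Theses.VdwKissingSutherland

/-!
# Route VdwKissingSutherland — item 12233 `Assembly`

Item `stmt-AtomisticToContinuum-12233` (assembly, rank 1) of route
`route-AtomisticToContinuum-VdwKissingSutherland`:

`VdwKissing → SutherlandStable → KissingStableGlue → LjGroundStatesNearInvSixMax →
 NearMaxGroundStatesCrystallize → CrysPeriodicMinAttained → CrysEnergyLimit → Crystallization`
(conclusion: the sub-problem decl `_root_.Crystallization`, i.e.
`HasPeriodicGroundStateEnergy lennardJones 3 ∧ IsCrystallizing lennardJones 3`).

PROOF (pure bookkeeping over the seven items; it is the same script as the route file's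
planner-authored deciding theorem `…Theses.VdwKissingSutherland.closes`, repeated here so that this
file depends only on the item decls, not on that theorem):

* packing engine: `KissingStableGlue` applied to `VdwKissing` and `SutherlandStable` gives the plain
  Sutherland bound `Σ_i Σ_j dist(y i, y j)⁻⁶ ≤ M · L₆(hcp)` for every finite unit packing `y` of `M`
  points, hence `S₆(y)/M ≤ L₆(hcp)` (`div_le_of_le_mul₀`; `M = 0` is covered because `L₆(hcp) ≥ 0`
  by `tsum_nonneg`);
* positional half: the conclusion of `LjGroundStatesNearInvSixMax` (benchmark `L₆(hcp) − 1/20`)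
  therefore implies the hypothesis of `NearMaxGroundStatesCrystallize` (benchmark `S₆(y)/M − 1/20`
  for every `y`), by `filter_upwards` + `gcongr`, giving `IsCrystallizing lennardJones 3`;
* energetic half: `CrysPeriodicMinAttained` gives `P` with `IsLeast`, so `⨅_Q e(Q) = e(P)`
  (`IsLeast.csInf_eq`) and `CrysEnergyLimit` is the limit clause of
  `HasPeriodicGroundStateEnergy lennardJones 3`.
-/

namespace Summit.AtomisticToContinuum.Crystallization.Theorems

open Filter Topology
open Summit.AtomisticToContinuum.Crystallization.Theses.VdwKissingSutherland

/-- **Item 12233 `Assembly`** (route `VdwKissingSutherland`, by name): the seven items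
`VdwKissing`, `SutherlandStable`, `KissingStableGlue`, `LjGroundStatesNearInvSixMax`,
`NearMaxGroundStatesCrystallize`, `CrysPeriodicMinAttained`, `CrysEnergyLimit` imply the
sub-problem `Crystallization`.  Pure logic over the items: the glue turns cruxes 2–3 into the
Sutherland bound, which makes the hcp benchmark of crux 4 dominate `S₆(y)/M` for every finite unit
packing `y` (so crux 5 fires), and `IsLeast.csInf_eq` identifies the limit in `CrysEnergyLimit`
with the attained periodic minimum; same argument as the route's deciding theorem `closes`.
[folklore] -/
theorem vdwKissingSutherland_assembly_proof :
    Summit.AtomisticToContinuum.Crystallization.Theses.VdwKissingSutherland.Assembly := by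
  unfold Summit.AtomisticToContinuum.Crystallization.Theses.VdwKissingSutherland.Assembly
  intro h_VdwKissing h_SutherlandStable h_KissingStableGlue h_LjGroundStatesNearInvSixMax
    h_NearMaxGroundStatesCrystallize h_CrysPeriodicMinAttained h_CrysEnergyLimit
  -- (1) packing engine: the two-shell inequality (crux 2) makes every two-shell deficit
  --     non-negative, so the deficit-stable Sutherland bound (crux 3) yields the plain r⁻⁶ packing
  --     bound through the glue item
  have hS : SutherlandBound := h_KissingStableGlue h_VdwKissing h_SutherlandStable
  -- the hcp benchmark L₆ = Σ_{y ∈ hcp} ‖y‖⁻⁶ is non-negative (covers the empty competitor M = 0,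
  -- where S₆(y)/M = 0/0 = 0)
  have hL : (0 : ℝ) ≤
      ∑' y : ↥(Literature.MathematicalPhysics.StatisticalMechanics.hcpStacking 1 (Real.sqrt (2 / 3))),
        ‖(y : EuclideanSpace ℝ (Fin 3))‖⁻¹ ^ 6 :=
    tsum_nonneg fun y => by positivity
  -- (2) positional half: LJ ground states are 1/20-near the hcp benchmark after cleaning/rescaling
  --     (crux 4); by the Sutherland bound the hcp benchmark dominates S₆(y)/M for every finite unit
  --     packing y of M points, so they are 1/20-near the packing supremum — the hypothesis of the
  --     rigidity endgame (crux 5)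
  have hpos : Literature.MathematicalPhysics.StatisticalMechanics.IsCrystallizing
      Literature.MathematicalPhysics.StatisticalMechanics.lennardJones 3 := by
    apply h_NearMaxGroundStatesCrystallize
    intro x hx
    filter_upwards [h_LjGroundStatesNearInvSixMax x hx] with N hN
    obtain ⟨S, c, hcard, hc1, hc2, hpack, hsum⟩ := hN
    refine ⟨S, c, hcard, hc1, hc2, hpack, ?_⟩
    intro M y hy
    have hy' := hS M y hy
    have hdiv : (∑ i, ∑ j, (dist (y i) (y j))⁻¹ ^ 6) / (M : ℝ) ≤
        ∑' z : ↥(Literature.MathematicalPhysics.StatisticalMechanics.hcpStacking 1 (Real.sqrt (2 / 3))),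
          ‖(z : EuclideanSpace ℝ (Fin 3))‖⁻¹ ^ 6 :=
      div_le_of_le_mul₀ (Nat.cast_nonneg M) hL (by rw [mul_comm]; exact hy')
    calc (S.card : ℝ) * ((∑ i, ∑ j, (dist (y i) (y j))⁻¹ ^ 6) / M - 1 / 20)
        ≤ (S.card : ℝ) *
            ((∑' z : ↥(Literature.MathematicalPhysics.StatisticalMechanics.hcpStacking 1
                (Real.sqrt (2 / 3))), ‖(z : EuclideanSpace ℝ (Fin 3))‖⁻¹ ^ 6) - 1 / 20) := by
          gcongr
      _ ≤ ∑ i ∈ S, ∑ j ∈ S, (c * dist (x N i) (x N j))⁻¹ ^ 6 := hsum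
  -- (3) energetic half: the periodic minimum is attained at some P (crux 6), so ⨅_Q e(Q) = e(P)
  --     (IsLeast.csInf_eq), and the bookkeeping limit E(N)/N → ⨅_Q e(Q) (support 0626) is the
  --     limit clause of HasPeriodicGroundStateEnergy
  obtain ⟨P, hP⟩ := h_CrysPeriodicMinAttained
  have hinf : (⨅ Q : Literature.MathematicalPhysics.StatisticalMechanics.PeriodicConfiguration 3,
      Q.energyPerParticle Literature.MathematicalPhysics.StatisticalMechanics.lennardJones) =
      P.energyPerParticle Literature.MathematicalPhysics.StatisticalMechanics.lennardJones :=
    hP.csInf_eq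
  have hlim : Filter.Tendsto
      (fun N : ℕ => Literature.MathematicalPhysics.StatisticalMechanics.groundStateEnergy
        Literature.MathematicalPhysics.StatisticalMechanics.lennardJones 3 N / N) Filter.atTop
      (nhds (P.energyPerParticle Literature.MathematicalPhysics.StatisticalMechanics.lennardJones)) := by
    have h0 : CrysEnergyLimit := h_CrysEnergyLimit
    unfold CrysEnergyLimit at h0
    rw [hinf] at h0
    exact h0
  -- Crystallization = HasPeriodicGroundStateEnergy lennardJones 3 ∧ IsCrystallizing lennardJones 3
  exact ⟨⟨P, hP, hlim⟩, hpos⟩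

end Summit.AtomisticToContinuum.Crystallization.Theorems
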